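import Literature.NumberTheory.LFunctions.Zhang2022.KnifeEdgeSlotCalculus
import Literature.NumberTheory.LFunctions.Zhang2022.KnifeEdgeRoughOverhang

/-!
# Zhang (2022), rung F-S3 (Landau–Siegel programme, §D edge len = E*-len⁺): the two coefficient / profile CLASSES a
# len card may name — the weighted profile polynomial (class (O2)) and the wall-jump overhang piece (class (O1)) —
# with the kernel deltas against the dead smooth class, and the band coordinate

Y. Zhang, *Discrete mean estimates and the Landau–Siegel zero*, arXiv:2211.02515v1 [Zhang2022LandauSiegel] — an
unrefereed manuscript under adjudication. **WHAT THIS IS NOT: not a claim about Theorems 1–2 of arXiv:2211.02515, about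
Landau–Siegel zeros, or about Parity. The programme SEARCHES and TYPES; no claim about Landau–Siegel zeros, Theorems 1–2
of arXiv:2211.02515 or a repaired Margin232 until a kernel theorem says so. This file declares CLASSES (definitions) and
proves elementary facts about them; no estimate is asserted.**

What is here (the cell's OBJECTIVE.md §1.3 «outside R⁺» clauses (O1)/(O2), typed as predicates a §D len card can cite
by name instead of describing its class in prose):
* (O2) `profPolyW χ x N a 𝔤 s = Σ_{1≤n<N} a(n)·χψ(n)·𝔤(log n/log P)·n^{−s}` — the profile polynomial of
  `KnifeEdgeEStarLen` with an extra ARITHMETIC weight `a` (`μ`, `Λ`, divisor-type, a Kloosterman weight …);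
  `profPolyW_one`: `a ≡ 1` is `KnifeEdge.profPoly`.
* (O1) `WallJumpPiece θ h v v′` — an overhang piece of logarithmic length `θ` with a JUMP `h` at the wall: `v = v′ = 0`
  below `z = 1`, `v(1) = h`, `v` continuous on `[1,θ]` with a marked right derivative in `L²`; top value free.
  Deltas (proved): `WallJumpPiece.rough` — it IS a `RoughOverhangPiece θ` (p457552), so `rough_closes_needs_cross` /
  `rough_not_closes` (slots E-005/E-006) apply to the class; `WallJumpPiece.not_overhangPiece` — for `h ≠ 0` it is NOT
  in the dead smooth class `OverhangPiece θ` of `KnifeEdgeOverhangRankOne` (p442741); `wallJumpPiece_wallRamp` — the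
  class is inhabited at every `θ > 1` (the linear ramp from the wall); packaged: `exists_rough_wallJump_not_overhangPiece`.
* the band coordinate `bandCoord D z = (z − 1)/α̃` of `KnifeEdgeWallBand.wallProfile`'s band shapes and the identity
  `bigP_mul_eq_rpow : P·(D·t₀) = P^{1+α̃}` (the band `P < n ≤ P·D·t₀` is `z ∈ (1, 1+α̃]`, (2.30)).
Slot shapes, splits and compositions are in `KnifeEdgeSlotCalculus` (p461073); the E-rows in `KnifeEdgeOffDiagForm`,
`KnifeEdgeWallBand`, `KnifeEdgeWallCross`. Originally the seat kit `LenTypingKit.lean` of ls-knife-typer-1 (cell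
landau-siegel), whose shape section landed verbatim in p458017.

## References
* Y. Zhang, arXiv:2211.02515v1 (2022), §1 p.3 (the `μψ f` mollifier remark), §2 (2.23), (2.30), §7 Prop 7.1 (7.2) p.44.
  [cite: Zhang2022LandauSiegel, §2, §7]
-/

noncomputable section

open Complex Real ComplexConjugate Set
open _root_.MeasureTheory

namespace Literature.NumberTheory.LFunctions.Zhang2022

namespace KnifeEdge

open Skeleton Repair

/-! ### (1) the weighted profile polynomial (class (O2)) -/

section Weighted

variable {D : ℕ} (χ : DirichletCharacter ℂ D)

/-- The weighted profile polynomial `Σ_{1 ≤ n < N} a(n)·χψ(n)·𝔤(log n / log P)·n^{−s}` with an extra ARITHMETIC weight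
`a` (class (O2) of the cell's OBJECTIVE §1.3: `a = μ`, `Λ`, divisor-type, … — a coefficient class whose diagonal main term
need not be a Gram value of `𝔅`; `a = 1` is `profPoly`). [cite: Zhang2022LandauSiegel, §2 (2.23); §1 p.3 (the `μψ f` mollifier remark)] -/
def profPolyW (x : Chr D) (N : ℕ) (a : ℕ → ℂ) (𝔤 : ℝ → ℂ) (s : ℂ) : ℂ :=
  ∑ n ∈ Finset.Ico 1 N, a n * pc χ x n * 𝔤 (Real.log n / Real.log (bigP D)) * (n : ℂ) ^ (-s)

/-- `profPolyW` with the trivial weight is `profPoly`. [cite: Zhang2022LandauSiegel, §2 (2.23)] -/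
theorem profPolyW_one (x : Chr D) (N : ℕ) (𝔤 : ℝ → ℂ) (s : ℂ) :
    profPolyW χ x N (fun _ => 1) 𝔤 s = profPoly χ x 𝔤 N s := by
  simp [profPolyW, profPoly]

end Weighted

/-! ### (2) the (O1) class: an overhang piece with a JUMP at the wall `z = 1` -/

/-- A **wall-jump overhang piece** of logarithmic length `θ` with jump `h` at the wall: `v = v′ = 0` below `z = 1`,
`v(1) = h` (the right value at the wall), `v` continuous on `[1, θ]` with a marked right derivative `v′ ∈ L²(1,θ)`; the
top value `v(θ)` is FREE.  For `h = 0` and `v(θ) = 0` this is `KnifeEdge.OverhangPiece θ` (the dead smooth class);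
`h ≠ 0` is class (O1) «g(1⁻) ≠ g(1⁺)» of the cell's OBJECTIVE §1.3. [cite: Zhang2022LandauSiegel, §7 (7.2) p.44] -/
structure WallJumpPiece (θ : ℝ) (h : ℂ) (v v' : ℝ → ℂ) : Prop where
  cont : ContinuousOn v (Icc 1 θ)
  hasDeriv : ∀ x ∈ Ico (1:ℝ) θ, HasDerivWithinAt v (v' x) (Ioi x) x
  memLp : MemLp v' 2 (volume.restrict (Ioc 1 θ))
  vanish : ∀ y, y < 1 → v y = 0
  vanish' : ∀ y, y < 1 → v' y = 0
  wall : v 1 = h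


section Delta

variable {θ : ℝ} {h : ℂ} {v v' : ℝ → ℂ}

/-- A wall-jump piece with `h ≠ 0` is NOT in the smooth top-vanishing class of `KnifeEdgeOverhangRankOne`
(`OverhangPiece.vanish` forces `v 1 = 0`). [cite: Zhang2022LandauSiegel, §7 (7.2) p.44] -/
theorem WallJumpPiece.not_overhangPiece (hv : WallJumpPiece θ h v v') (hh : h ≠ 0) : ¬ OverhangPiece θ v v' := by
  intro ho
  exact hh (hv.wall ▸ ho.vanish 1 le_rfl)

/-- The linear ramp from the wall: `ρ_{θ,h}(y) = h·(θ − y)/(θ − 1)` on `[1, ∞)`, `0` below. [cite: Zhang2022LandauSiegel, §7 (7.2) p.44] -/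
def wallRamp (θ : ℝ) (h : ℂ) (y : ℝ) : ℂ := if y < 1 then 0 else h * (((θ - y) / (θ - 1) : ℝ) : ℂ)

/-- Its right derivative: `−h/(θ − 1)` on `[1, ∞)`, `0` below. [cite: Zhang2022LandauSiegel, §7 (7.2) p.44] -/
def wallRamp' (θ : ℝ) (h : ℂ) (y : ℝ) : ℂ := if y < 1 then 0 else h * (((-1) / (θ - 1) : ℝ) : ℂ)

/-- The wall ramp is a wall-jump piece with jump `h` (so the (O1) class is inhabited for every `θ > 1`, `h`).
[cite: Zhang2022LandauSiegel, §7 (7.2) p.44] -/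
theorem wallJumpPiece_wallRamp (hθ : 1 < θ) (h : ℂ) : WallJumpPiece θ h (wallRamp θ h) (wallRamp' θ h) where
  cont := by
    have hc : Continuous fun y : ℝ => h * (((θ - y) / (θ - 1) : ℝ) : ℂ) := by fun_prop
    refine hc.continuousOn.congr fun y hy => ?_
    simp [wallRamp, not_lt.2 hy.1]
  hasDeriv := by
    intro x hx
    have hx1 : 1 ≤ x := hx.1
    have hlin : HasDerivAt (fun y : ℝ => h * (((θ - y) / (θ - 1) : ℝ) : ℂ)) (h * (((-1) / (θ - 1) : ℝ) : ℂ)) x := by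
      have h1 : HasDerivAt (fun y : ℝ => (θ - y) / (θ - 1)) ((-1) / (θ - 1)) x := by
        have := ((hasDerivAt_id x).const_sub θ).div_const (θ - 1)
        simpa using this
      have h2 : HasDerivAt (fun y : ℝ => (((θ - y) / (θ - 1) : ℝ) : ℂ)) ((((-1) / (θ - 1) : ℝ) : ℂ)) x :=
        h1.ofReal_comp
      exact h2.const_mul h
    have hev : (fun y : ℝ => h * (((θ - y) / (θ - 1) : ℝ) : ℂ)) =ᶠ[nhdsWithin x (Ioi x)] wallRamp θ h := by
      filter_upwards [self_mem_nhdsWithin] with y hy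
      have : ¬ y < 1 := not_lt.2 (hx1.trans (le_of_lt hy))
      simp [wallRamp, this]
    have := (hlin.hasDerivWithinAt (s := Ioi x)).congr_of_eventuallyEq hev.symm (by simp [wallRamp, not_lt.2 hx1])
    simpa [wallRamp', not_lt.2 hx1] using this
  memLp := by
    have hc : Continuous fun _ : ℝ => h * (((-1) / (θ - 1) : ℝ) : ℂ) := continuous_const
    refine (memLp_top_const (μ := volume.restrict (Ioc 1 θ)) (h * (((-1) / (θ - 1) : ℝ) : ℂ))).mono_exponent
      (p := 2) le_top |>.ae_eq ?_
    filter_upwards [ae_restrict_mem measurableSet_Ioc] with y hy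
    simp [wallRamp', not_lt.2 hy.1.le]
  vanish := fun y hy => by simp [wallRamp, hy]
  vanish' := fun y hy => by simp [wallRamp', hy]
  wall := by simp [wallRamp, sub_ne_zero.2 (ne_of_gt hθ)]

/-- **Typed delta, packaged:** for every `θ > 1` and `h ≠ 0` the (O1) class contains a piece outside the dead class.
[cite: Zhang2022LandauSiegel, §7 (7.2) p.44] -/
theorem exists_wallJumpPiece_not_overhangPiece (hθ : 1 < θ) (hh : h ≠ 0) :
    ∃ v v' : ℝ → ℂ, WallJumpPiece θ h v v' ∧ ¬ OverhangPiece θ v v' :=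
  ⟨wallRamp θ h, wallRamp' θ h, wallJumpPiece_wallRamp hθ h, (wallJumpPiece_wallRamp hθ h).not_overhangPiece hh⟩

end Delta

/-! ### (2b) the wall-jump class sits inside p3's rough class -/

section Rough

variable {θ : ℝ} {h : ℂ} {v v' : ℝ → ℂ}

/-- A wall-jump piece is a `RoughOverhangPiece` (p457552): continuous on `[1,θ]` ⇒ `v ∈ L²(1,θ)`; one marked right
derivative everywhere on `[1,θ)` ⇒ the exceptional set is `∅`. Hence `KnifeEdge.rough_closes_needs_cross` /
`rough_not_closes` apply to the (O1) wall-jump class. [cite: Zhang2022LandauSiegel, §7 (7.2) p.44] -/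
theorem WallJumpPiece.rough (hv : WallJumpPiece θ h v v') : RoughOverhangPiece θ v v' where
  memLp := by
    obtain ⟨C, hC⟩ := isCompact_Icc.exists_bound_of_continuousOn hv.cont
    have hsub : Ioc 1 θ ⊆ Icc 1 θ := fun t ht => ⟨ht.1.le, ht.2⟩
    refine MemLp.of_bound ((hv.cont.mono hsub).aestronglyMeasurable measurableSet_Ioc) C ?_
    filter_upwards [ae_restrict_mem measurableSet_Ioc] with t ht using hC t (hsub ht)
  memLp' := hv.memLp
  pwDeriv := ⟨∅, fun x hx _ => hv.hasDeriv x hx⟩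
  vanish := hv.vanish
  vanish' := hv.vanish'

/-- **Typed delta, packaged for the rough class:** for `θ > 1`, `h ≠ 0` there is a rough overhang piece with a wall jump
that is NOT in the dead smooth class. [cite: Zhang2022LandauSiegel, §7 (7.2) p.44] -/
theorem exists_rough_wallJump_not_overhangPiece (hθ : 1 < θ) (hh : h ≠ 0) :
    ∃ v v' : ℝ → ℂ, RoughOverhangPiece θ v v' ∧ WallJumpPiece θ h v v' ∧ ¬ OverhangPiece θ v v' :=
  ⟨wallRamp θ h, wallRamp' θ h, (wallJumpPiece_wallRamp hθ h).rough, wallJumpPiece_wallRamp hθ h,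
    (wallJumpPiece_wallRamp hθ h).not_overhangPiece hh⟩

end Rough

/-! ### (3) the band coordinate (objects of record: `wallProfile`, `wallBandPoly`, `bandK` — p458037/p459102) -/

section Band

variable {D : ℕ}

/-- The scale-free band coordinate `w = (z − 1)/α̃`, `α̃ = log(Dt₀)/log P` (`Skeleton.alphaTilde`; the argument of
`WallData.band` in `wallProfile`). [cite: Zhang2022LandauSiegel, §2 (2.30)] -/
def bandCoord (D : ℕ) (z : ℝ) : ℝ := (z - 1) / alphaTilde D

/-- The band's upper end in the logarithmic scale: `P·(D·t₀) = P^{1+α̃}` whenever `D·t₀ > 0` and `log P ≠ 0`.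
[cite: Zhang2022LandauSiegel, §2 (2.30)] -/
theorem bigP_mul_eq_rpow (hDt : 0 < (D : ℝ) * t0 D) (hlog : Real.log (bigP D) ≠ 0) :
    bigP D * ((D : ℝ) * t0 D) = bigP D ^ (1 + alphaTilde D) := by
  have hP : 0 < bigP D := Real.exp_pos _
  rw [Real.rpow_add hP, Real.rpow_one, alphaTilde, Real.rpow_def_of_pos hP, mul_div_assoc',
    mul_div_cancel_left₀ _ hlog, Real.exp_log hDt]

/-- `w(1) = 0`. [cite: Zhang2022LandauSiegel, §2 (2.30)] -/
theorem bandCoord_one (D : ℕ) : bandCoord D 1 = 0 := by simp [bandCoord]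

/-- `w(1+α̃) = 1` (for `α̃ ≠ 0`). [cite: Zhang2022LandauSiegel, §2 (2.30)] -/
theorem bandCoord_one_add (hα : alphaTilde D ≠ 0) : bandCoord D (1 + alphaTilde D) = 1 := by
  simp [bandCoord, hα]

end Band

/-! ### (4) the ROUGH class in the decided `X`-world (appended 2026-08-26): `invisibleForm θ` kills every rough design

`KnifeEdgeOffDiagForm.invisibleForm θ = M_θ ∘ (cut at the wall) − M_θ` is the off-diagonal input of the DECIDED
smooth class (E-003).  On a ROUGH overhang piece (`RoughOverhangPiece θ`: wall jump, no top-vanishing, interior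
jumps) the cut is no longer literally `0` — `cutLe v` keeps the wall value `v(1)` — but it is `0` ALMOST EVERYWHERE,
and `Repair.MformTop` is a pure integral functional; so the invisible form still cancels the (rough) rank-one tail
coupling exactly and nets the overhang block to `0`: `crossCoeff = 0`, `overhangConst = 0`, the completed constant is
`|s|²𝔅(u) ≥ 0`, and NO rough / wall-jump two-piece design closes in the `invisibleForm`-world
(`nullOn_rough_invisibleForm`, `not_closesByPositivityIn_invisibleForm_wallJump`).  Reading for §D len (typed delta):
roughness ALONE does not leave the decided world; the `X` of an (O1) card must differ from `invisibleForm θ` — by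
the BAND content (registry E-005/E-006, `KnifeEdgeWallBand` / `KnifeEdgeWallCross`), not by the jump itself. -/

section RoughInvisible

variable {θ : ℝ} {h : ℂ} {u u' v v' : ℝ → ℂ}

/-- the marked derivative of a rough overhang piece is cut to zero (it vanishes below the wall).
[cite: Zhang2022LandauSiegel, §7 (7.2) p.44] -/
theorem cutLt_of_rough (hv : RoughOverhangPiece θ v v') : cutLt v' = 0 := by
  funext y
  by_cases hy : y < 1
  · simp [cutLt, hy, hv.vanish' y hy]
  · simp [cutLt, hy]

/-- a rough overhang piece is cut to zero ALMOST EVERYWHERE (the cut keeps only the wall value `v(1)`).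
[cite: Zhang2022LandauSiegel, §7 (7.2) p.44] -/
theorem cutLe_of_rough_ae (hv : RoughOverhangPiece θ v v') : cutLe v =ᵐ[volume] (0 : ℝ → ℂ) := by
  have h1 : ∀ y : ℝ, y ≠ 1 → cutLe v y = 0 := fun y hy => by
    by_cases hle : y ≤ 1
    · simp [cutLe, hle, hv.vanish y (lt_of_le_of_ne hle hy)]
    · simp [cutLe, hle]
  have hae : ({(1 : ℝ)}ᶜ : Set ℝ) ∈ ae volume := compl_mem_ae_iff.mpr (measure_singleton _)
  filter_upwards [hae] with y hy using h1 y hy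

/-- `M_T(g, h) = 0` when the second profile vanishes a.e. and its marked derivative is `0` (`M_T` is a pure integral
functional). [cite: Zhang2022LandauSiegel, Prop 7.1, (8.11)–(8.12)] -/
theorem MformTop_right_ae_zero (T : ℝ) (g g' : ℝ → ℂ) {f : ℝ → ℂ} (hf : f =ᵐ[volume] (0 : ℝ → ℂ)) :
    MformTop T g g' f 0 = 0 := by
  have hinner : ∀ y : ℝ, ∫ t in y..T, f t = 0 := fun y =>
    intervalIntegral.integral_zero_ae (by filter_upwards [hf] with t ht _ using ht)
  have hd : ∀ j : ℕ, ∫ y in (0:ℝ)..T, dipoleIntegrandTop T j g g' f 0 y = 0 := fun j =>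
    intervalIntegral.integral_zero_ae (by
      filter_upwards [hf] with y hy _
      simp [dipoleIntegrandTop, hinner y, hy])
  unfold MformTop
  rw [hd 1, hd 2, hd 3]
  ring

/-- `M_T(g, h) = 0` when the first profile vanishes a.e. and its marked derivative is `0`.
[cite: Zhang2022LandauSiegel, Prop 7.1, (8.11)–(8.12)] -/
theorem MformTop_left_ae_zero (T : ℝ) {g : ℝ → ℂ} (hg : g =ᵐ[volume] (0 : ℝ → ℂ)) (f f' : ℝ → ℂ) :
    MformTop T g 0 f f' = 0 := by
  have hd : ∀ j : ℕ, ∫ y in (0:ℝ)..T, dipoleIntegrandTop T j g 0 f f' y = 0 := fun j =>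
    intervalIntegral.integral_zero_ae (by
      filter_upwards [hg] with y hy _
      simp [dipoleIntegrandTop, hy])
  unfold MformTop
  rw [hd 1, hd 2, hd 3]
  ring

/-- On an in-class × ROUGH design the invisible form takes the same values as on the smooth class:
`X(u,v) = −M_θ(u,v)`, `X(v,v) = −M_θ(v,v)`. [cite: Zhang2022LandauSiegel, §7 Prop 7.1 (7.2) p.44] -/
theorem invisibleForm_apply_inClass_rough (hu : InClassPiece u u') (hv : RoughOverhangPiece θ v v') :
    invisibleForm θ u u' v v' = -MformTop θ u u' v v'
    ∧ invisibleForm θ v v' v v' = -MformTop θ v v' v v' := by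
  simp only [invisibleForm, cutLe_of_inClass hu, cutLt_of_inClass hu, cutLt_of_rough hv,
    MformTop_right_ae_zero _ _ _ (cutLe_of_rough_ae hv), zero_sub, and_self]

/-- **In the `invisibleForm`-world a rough design has cross coefficient `0` and overhang constant `0`** (the
invisible form cancels the rough rank-one tail coupling `KnifeEdge.rough_rankOneTailCoupling` exactly).
[cite: Zhang2022LandauSiegel, §7 Prop 7.1 (7.2) p.44, (8.11)–(8.12)] -/
theorem crossCoeff_invisibleForm_rough (hθ : 1 ≤ θ) (hu : InClassPiece u u') (hv : RoughOverhangPiece θ v v') :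
    crossCoeff θ (invisibleForm θ) u u' v v' = 0 ∧ overhangConst θ (invisibleForm θ) v v' = 0 := by
  obtain ⟨h1, h2⟩ := invisibleForm_apply_inClass_rough hu hv
  obtain ⟨hc, _⟩ := rough_rankOneTailCoupling hθ hu hv
  refine ⟨?_, ?_⟩
  · rw [crossCoeff, tailCoupling, h1, hc, add_neg_cancel]
  · rw [overhangConst, h2, topDiagForm_re, Complex.neg_re]
    ring

/-- **No rough design closes in the `invisibleForm`-world:** the completed constant is `|s|²𝔅(u) ≥ 0`.
[cite: Zhang2022LandauSiegel, §7 Prop 7.1 (7.2) p.44] -/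
theorem nullOn_rough_invisibleForm (hθ : 1 ≤ θ) : NullOn (RoughOverhangPiece θ) θ (invisibleForm θ) := by
  intro u u' v v' s hu hv
  obtain ⟨hc, hk⟩ := crossCoeff_invisibleForm_rough hθ hu hv
  rw [twoPieceMainTerm_eq, hc, hk, mul_zero, Complex.zero_re, mul_zero, add_zero, add_zero]
  exact mul_nonneg (mainTermForm_nonneg_of_isH1 hu.kinked.isH1) (sq_nonneg _)

/-- … equivalently `¬ ClosesByPositivityOn (RoughOverhangPiece θ) θ (invisibleForm θ)` — the decided world stays
decided for the whole rough class. [cite: Zhang2022LandauSiegel, §7 Prop 7.1 (7.2) p.44] -/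
theorem not_closesOn_rough_invisibleForm (hθ : 1 ≤ θ) :
    ¬ ClosesByPositivityOn (RoughOverhangPiece θ) θ (invisibleForm θ) :=
  fun hcl => (closesByPositivityOn_iff_not_nullOn.1 hcl) (nullOn_rough_invisibleForm hθ)

/-- **Typed delta for (O1) cards:** no WALL-JUMP design closes in the `invisibleForm`-world — a wall jump is a
lever only through an `X` that differs from the invisible form (the band rows E-005/E-006), never by itself.
[cite: Zhang2022LandauSiegel, §7 Prop 7.1 (7.2) p.44] -/
theorem not_closesByPositivityIn_invisibleForm_wallJump (hθ : 1 ≤ θ) (h : ℂ) :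
    ¬ ClosesByPositivityIn θ (invisibleForm θ) (WallJumpPiece θ h) := by
  rintro ⟨u, u', v, v', s, hu, hv, hneg⟩
  exact not_le.mpr hneg (nullOn_rough_invisibleForm hθ u u' v v' s hu hv.rough)

end RoughInvisible

/-! ### (5) bookkeeping between the two class vocabularies (appended 2026-08-26): p3's `…On V θ X` (class first)
and p458017's `…In θ X 𝒱` (class last) are the SAME statements; slots and rows are monotone in the class -/

section ClassBookkeeping

variable {c' θ : ℝ} {X : PairFunctional} {𝒱 𝒲 : (ℝ → ℂ) → (ℝ → ℂ) → Prop}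

/-- `ClosesByPositivityIn θ X 𝒱` (`KnifeEdgeOffDiagForm`) IS `ClosesByPositivityOn 𝒱 θ X` (`KnifeEdgeRoughOverhang`).
[cite: Zhang2022LandauSiegel, §7 Prop 7.1 (7.2) p.44] -/
theorem closesByPositivityIn_iff_on : ClosesByPositivityIn θ X 𝒱 ↔ ClosesByPositivityOn 𝒱 θ X := Iff.rfl

/-- Closing in a subclass closes in the superclass. [cite: Zhang2022LandauSiegel, §7 Prop 7.1 (7.2) p.44] -/
theorem ClosesByPositivityIn.mono (h𝒱𝒲 : ∀ v v', 𝒱 v v' → 𝒲 v v') (h : ClosesByPositivityIn θ X 𝒱) :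
    ClosesByPositivityIn θ X 𝒲 := by
  obtain ⟨u, u', v, v', s, hu, hv, hlt⟩ := h
  exact ⟨u, u', v, v', s, hu, h𝒱𝒲 v v' hv, hlt⟩

/-- A null on a superclass is a null on every subclass — e.g. `nullOn_rough_invisibleForm` gives the wall-jump
class. [cite: Zhang2022LandauSiegel, §7 Prop 7.1 (7.2) p.44] -/
theorem not_closesByPositivityIn_of_nullOn (h𝒱𝒲 : ∀ v v', 𝒱 v v' → 𝒲 v v') (h : NullOn 𝒲 θ X) :
    ¬ ClosesByPositivityIn θ X 𝒱 := by
  rintro ⟨u, u', v, v', s, hu, hv, hlt⟩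
  exact not_le.mpr hlt (h u u' v v' s hu (h𝒱𝒲 v v' hv))

/-- The E-002 row is antitone in the class: an asymptotic for a class gives it for every subclass.
[cite: Zhang2022LandauSiegel, §7 Prop 7.1 (7.2), §8 (8.23)] -/
theorem EStarLenPlusShape.anti (h𝒱𝒲 : ∀ v v', 𝒱 v v' → 𝒲 v v') (h : EStarLenPlusShape c' θ X 𝒲) :
    EStarLenPlusShape c' θ X 𝒱 :=
  fun u u' v v' s hu hv => h u u' v v' s hu (h𝒱𝒲 v v' hv)

/-- The cross slot is antitone in the class. [cite: Zhang2022LandauSiegel, §7 (7.2), §8 (8.5)] -/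
theorem CrossMean.anti (h𝒱𝒲 : ∀ v v', 𝒱 v v' → 𝒲 v v') (h : CrossMean c' θ X 𝒲) : CrossMean c' θ X 𝒱 :=
  fun u u' v v' hu hv => h u u' v v' hu (h𝒱𝒲 v v' hv)

/-- The overhang slot is antitone in the class. [cite: Zhang2022LandauSiegel, §7 (7.2), §8 (8.3)] -/
theorem OverhangMean.anti (h𝒱𝒲 : ∀ v v', 𝒱 v v' → 𝒲 v v') (h : OverhangMean c' θ X 𝒲) : OverhangMean c' θ X 𝒱 :=
  fun v v' hv => h v v' (h𝒱𝒲 v v' hv)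

/-- `C`-boundedness of `X` is antitone in the class. [cite: Zhang2022LandauSiegel, §7 (7.2) p.44] -/
theorem OffDiagBoundedOn.anti {C : ℝ} (h𝒱𝒲 : ∀ v v', 𝒱 v v' → 𝒲 v v') (h : OffDiagBoundedOn θ C X 𝒲) :
    OffDiagBoundedOn θ C X 𝒱 :=
  fun u u' v v' hu hv => h u u' v v' hu (h𝒱𝒲 v v' hv)

/-- The wall-jump class sits inside the rough class (for `.anti` / `.mono`). [cite: Zhang2022LandauSiegel, §7 (7.2) p.44] -/
theorem wallJumpPiece_le_rough {h : ℂ} : ∀ v v', WallJumpPiece θ h v v' → RoughOverhangPiece θ v v' :=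
  fun _ _ hv => hv.rough

/-- The smooth class sits inside the rough class. [cite: Zhang2022LandauSiegel, §7 (7.2) p.44] -/
theorem overhangPiece_le_rough : ∀ v v', OverhangPiece θ v v' → RoughOverhangPiece θ v v' :=
  fun _ _ hv => hv.rough

end ClassBookkeeping

/-! ### (6) the critic's per-class reading of p3's slots (appended 2026-08-26): displayed slots on the ROUGH class
exclude the lever on EVERY subclass — one citable name for «X decided by (E-005, E-006) ⇒ no (O1) design closes» -/

section SlotsExcludeLever

variable {θ : ℝ} {X : PairFunctional} {𝒱 : (ℝ → ℂ) → (ℝ → ℂ) → Prop}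

/-- **Slots ⇒ no closing on any subclass of the rough class** (crit-1's F-len-2/F-len-9 reading as ONE lemma): if in
the `X`-world the net overhang blocks of rough pieces are `≥ 0` (`BandNonnegOn`, slot E-005) and the cross residuals are
Cauchy–Schwarz-subordinate (`CrossSubordinateOn`, slot E-006), then NO two-piece design with overhang in any class
`𝒱 ⊆ RoughOverhangPiece θ` closes by positivity (`KnifeEdge.nullOn_iff` of p457552 + `not_closesByPositivityIn_of_nullOn`).
[cite: Zhang2022LandauSiegel, §7 Prop 7.1 (7.2) p.44] -/
theorem not_closesByPositivityIn_of_slots (h𝒱 : ∀ v v', 𝒱 v v' → RoughOverhangPiece θ v v')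
    (hB : BandNonnegOn (RoughOverhangPiece θ) θ X) (hC : CrossSubordinateOn (RoughOverhangPiece θ) θ X) :
    ¬ ClosesByPositivityIn θ X 𝒱 :=
  not_closesByPositivityIn_of_nullOn h𝒱 (nullOn_iff.2 ⟨hB, hC⟩)

/-- The wall-jump instance: slots on the rough class ⇒ no wall-jump design closes, at any jump `h`.
[cite: Zhang2022LandauSiegel, §7 Prop 7.1 (7.2) p.44] -/
theorem not_closesByPositivityIn_wallJump_of_slots (h : ℂ)
    (hB : BandNonnegOn (RoughOverhangPiece θ) θ X) (hC : CrossSubordinateOn (RoughOverhangPiece θ) θ X) :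
    ¬ ClosesByPositivityIn θ X (WallJumpPiece θ h) :=
  not_closesByPositivityIn_of_slots wallJumpPiece_le_rough hB hC

/-- … and conversely, a closing design in a subclass of the rough class with band blocks `≥ 0` LOCATES the lever: a
cross residual beating the geometric mean (p3's `rough_closes_needs_cross`, transported to the class vocabulary).
[cite: Zhang2022LandauSiegel, §7 Prop 7.1 (7.2) p.44] -/
theorem closesByPositivityIn_needs_cross (h𝒱 : ∀ v v', 𝒱 v v' → RoughOverhangPiece θ v v')
    (h : ClosesByPositivityIn θ X 𝒱) (hB : BandNonnegOn (RoughOverhangPiece θ) θ X) :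
    ∃ u u' v v' : ℝ → ℂ, InClassPiece u u' ∧ RoughOverhangPiece θ v v' ∧
      mainTermForm u u' * netOverhangBlock θ X v v' < ‖crossResidual θ X u u' v v'‖ ^ 2 :=
  rough_closes_needs_cross (closesByPositivityIn_iff_on.1 (h.mono h𝒱)) hB

end SlotsExcludeLever

end KnifeEdge

end Literature.NumberTheory.LFunctions.Zhang2022

end
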